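import Literature.NumberTheory.EllipticCurves.CanonicalPAdicHeightSigmaThetaProofs
import HarnessLib

/-!
# The parallelogram law of the sigma formula (`canonicalPAdicHeight_parallelogram`): what it
# rests on after the proof files of the tree (proofs only)

Trunk T-NT-EC (Literature/NumberTheory/EllipticCurves). The named fact
`WeierstrassCurve.canonicalPAdicHeight_parallelogram` (`CanonicalPAdicHeightProofs.lean`;
Mazur–Stein–Tate 2006, §2.7: "`h_ρ` is quadratic because of property IV of `σ` in [MT91]") says
that for `W/ℚ` globally minimal, `p ≥ 5` good ordinary and `P, Q ∈ E(ℚ)` satisfying the local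
conditions with `P ≠ ±Q`, the sigma formula `ĥ_p(P) = log_p(den x(P)) - 2 log_p σ_p(z(P))`
satisfies `ĥ_p(P + Q) + ĥ_p(P - Q) = 2ĥ_p(P) + 2ĥ_p(Q)`.

The tree proves the printed argument completely EXCEPT for its analytic input about `σ_p`:
`canonicalPAdicHeight_parallelogram_of_theta` (`CanonicalPAdicHeightParallelogramProofs.lean`)
derives the law from the theta relation `padicSigma_theta` and Néron's denominator law
`padicValNat_den_parallelogram`, and the latter is the theorem
`padicValNat_den_parallelogram_holds` (`CanonicalPAdicHeightLeavesProofs.lean`). This file records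
the resulting one-hypothesis reductions, so that the discharge of the fact is literally one
application away from each of the remaining inputs:

* `canonicalPAdicHeight_parallelogram_of_padicSigma_theta` —
  `padicSigma_theta → canonicalPAdicHeight_parallelogram` (the ONE remaining hop);
* `canonicalPAdicHeight_parallelogram_of_exists_pair` — from the EXISTENCE half of
  Mazur–Stein–Tate 2006 Thm. 1.3 (an integral, odd, normalised solution `(σ, c)` of the sigma
  differential equation exists for `W ⊗ ℚ_p`; Mazur–Tate 1991 Thm. 3.1) together with the formal
  theta identity `padicSigma_theta_formal` (Blakestad–Grant 2023, Prop. 14), via the tree's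
  `padicSigma_theta_of_exists_pair` (θ₃ = `formalGroupLaw_padicEval_holds` being a theorem);
* `canonicalPAdicHeight_parallelogram_of_MT_theta` — from the two named facts
  `mazur_tate_sigma_existsUnique` and `padicSigma_theta_formal` as stated in the tree;
* `canonicalPAdicHeight_parallelogram_of_forall_thetaLHS_eq` — from the single formal identity
  `thetaLHS σ_p = thetaRHS σ_p` in `ℚ_p⟦u, v⟧` for the chosen sigma series of each `W ⊗ ℚ_p`
  (pointwise version `canonicalPAdicHeight_parallelogram_of_thetaLHS_eq` of
  `CanonicalPAdicHeightSigmaThetaProofs.lean`, which needs only `p ≠ 2`).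

Why the existence of the Mazur–Tate pair cannot be bypassed: `padicSigma` is the chosen integral
pair when one exists and the junk series `t` otherwise, and for the junk series the "height"
`log_p(den x) - 2 log_p(-x/y)` is not a quadratic function; the fact is true precisely because
Mazur–Tate's existence theorem holds. That theorem (integrality of `σ`, obtained in
Blakestad–Grant 2023 Thms. 1–2 from the `p`-isogenous curve `E/Ê[p]` and Hazewinkel's functional
equation lemma, in Mazur–Tate 1991 from the dual isogenies of `E/Ê[pⁿ]`) is not in the tree.

## Sources

* B. Mazur, W. Stein, J. Tate, *Computation of `p`-adic heights and log convergence*, Doc. Math.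
  Extra Vol. Coates (2006): p. 3, Thm. 1.3 ("proved in [MT91]") and Remark 1.4; p. 10, §2.7
  ("`h_ρ` is quadratic because of property IV of `σ` in [MT91] … see also property III").
  [MazurSteinTate2006]
* B. Mazur, J. Tate, *The `p`-adic sigma function*, Duke Math. J. 62 (1991), Thm. 3.1 (as cited in
  MST 2006 and Blakestad–Grant 2023 §1, §3). [MazurTate1991]
* C. Blakestad, D. Grant, J. Number Theory 249 (2023) (arXiv:1903.02480): §1–2 (Thms. 1, 2: the
  universal `σ`, `ζ`; integrality via Hazewinkel and `E' = E/Ê[p]`), Prop. 14, Thm. 15.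
  [BlakestadGrant2023]

## Design notes

Pure proof file: no definition, no named fact, no statement is restated; every theorem is a
composition of theorems of the imported files. It introduces nothing the gate must trust.
-/

noncomputable section

open scoped Classical
open PowerSeries Literature.NumberTheory.EllipticCurves

namespace WeierstrassCurve

/-- **`canonicalPAdicHeight_parallelogram` from the theta relation alone.** The parallelogram law
of the sigma formula on generic admissible pairs follows from the Mazur–Tate theta relation of
`σ_p` at rational points of the kernel of reduction (`padicSigma_theta`); Néron's denominator law,
the multiplicativity of `log_p`, `σ_p ≠ 0` on `E₁(ℚ_p)` and the subgroup property of the admissible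
locus are theorems of the tree. [Mazur–Stein–Tate 2006, §2.7; Mazur–Tate 1991, Thm. 3.1]
[cite: MazurSteinTate2006, §2.7] -/
theorem canonicalPAdicHeight_parallelogram_of_padicSigma_theta (hθ : padicSigma_theta) :
    canonicalPAdicHeight_parallelogram :=
  canonicalPAdicHeight_parallelogram_of_theta hθ padicValNat_den_parallelogram_holds

/-- **`canonicalPAdicHeight_parallelogram` from the existence of a Mazur–Tate pair and the formal
theta identity.** If for every globally minimal elliptic `W/ℚ` and every prime `p ≥ 5` of good
ordinary reduction SOME integral, odd, normalised solution `(σ, c)` of the sigma differential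
equation exists for `W ⊗ ℚ_p` (existence half of MST 2006 Thm. 1.3 = Mazur–Tate 1991 Thm. 3.1),
and such solutions satisfy the formal theta identity (`padicSigma_theta_formal`, Blakestad–Grant
2023 Prop. 14), then the parallelogram law holds. [Mazur–Stein–Tate 2006, Thm. 1.3, §2.7;
Blakestad–Grant 2023, Prop. 14] [cite: MazurSteinTate2006, §2.7] -/
theorem canonicalPAdicHeight_parallelogram_of_exists_pair
    (hex : ∀ (W : WeierstrassCurve ℚ) [W.IsElliptic] [W.IsGloballyMinimal] (p : ℕ) [Fact p.Prime],
      5 ≤ p → W.HasGoodReductionAtPrime p → ¬ (p : ℤ) ∣ W.frobeniusTrace p →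
        ∃ σ : ℚ_[p]⟦X⟧, ∃ c : ℚ_[p], (W.baseChange ℚ_[p]).IsMazurTateSigmaPair σ c)
    (hθ : padicSigma_theta_formal) : canonicalPAdicHeight_parallelogram :=
  canonicalPAdicHeight_parallelogram_of_padicSigma_theta (padicSigma_theta_of_exists_pair hex hθ)

/-- **`canonicalPAdicHeight_parallelogram` from the two named facts of the tree behind `σ_p`**:
`mazur_tate_sigma_existsUnique` (MST 2006 Thm. 1.3, `PadicSigma.lean`) and
`padicSigma_theta_formal` (Blakestad–Grant 2023 Prop. 14, `CanonicalPAdicHeightThetaProofs.lean`);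
only the existence clause of the former is used. [Mazur–Stein–Tate 2006, Thm. 1.3, §2.7]
[cite: MazurSteinTate2006, §2.7] -/
theorem canonicalPAdicHeight_parallelogram_of_MT_theta (hMT : mazur_tate_sigma_existsUnique)
    (hθ : padicSigma_theta_formal) : canonicalPAdicHeight_parallelogram :=
  canonicalPAdicHeight_parallelogram_of_padicSigma_theta (padicSigma_theta_of_MT_theta hMT hθ)

/-- **`canonicalPAdicHeight_parallelogram` from one formal identity per curve and prime**: if for
every globally minimal elliptic `W/ℚ` and every prime `p ≥ 5` of good ordinary reduction the sigma
series `σ_p` of `W ⊗ ℚ_p` satisfies `σ(F(u,v)) σ(F(u,i(v))) u²v² = (u²X(v) - v²X(u)) σ(u)² σ(v)²`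
in `ℚ_p⟦u, v⟧` (`thetaLHS σ_p = thetaRHS σ_p`), the parallelogram law holds (pointwise version:
`canonicalPAdicHeight_parallelogram_of_thetaLHS_eq`, which needs only `p ≠ 2`).
[Mazur–Stein–Tate 2006, §2.7; Blakestad–Grant 2023, Prop. 14, Thm. 15] [folklore] -/
theorem canonicalPAdicHeight_parallelogram_of_forall_thetaLHS_eq
    (h : ∀ (W : WeierstrassCurve ℚ) [W.IsElliptic] [W.IsGloballyMinimal] (p : ℕ) [Fact p.Prime],
      5 ≤ p → W.HasGoodReductionAtPrime p → ¬ (p : ℤ) ∣ W.frobeniusTrace p →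
        (W.baseChange ℚ_[p]).thetaLHS (W.baseChange ℚ_[p]).padicSigma =
          (W.baseChange ℚ_[p]).thetaRHS (W.baseChange ℚ_[p]).padicSigma) :
    canonicalPAdicHeight_parallelogram := by
  intro W _ _ p _ hp hgood hord P Q hP hQ hsub hadd
  exact canonicalPAdicHeight_parallelogram_of_thetaLHS_eq (by omega) (h W p hp hgood hord) P Q hP hQ
    hsub hadd

end WeierstrassCurve
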